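import Literature.NumberTheory.GaloisCohomology.Howard2004.CasselsTateSkewPairingDecompositionModelProofs
import Literature.NumberTheory.GaloisCohomology.Howard2004.EngineDecompositionsOfSkewPairingFactProofs
import HarnessLib

/-!
# Howard 2004: the typed print leaf C45.1′ `prop141_casselsTate_skewPairing_atLevel` (Prop. 1.4.1 / Flach + displays (i)(ii)
# of the proof of Thm. 1.4.2) FROM Thm. 1.4.2-as-applied (`HasLevelDecompositionsAt`) — and hence EQUIVALENT to it — proofs file

Topic `NumberTheory/GaloisCohomology/Howard2004`. THEOREMS ONLY: no definition, no named fact, no instance, no notation, no `sorry`.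
Cell `pub/bsd-print-x9` (seat x10b-p1-w7 g11, brick «C451-CONVERSE», `--supports stmt-BirchSwinnertonDyer-22642`; crux of record
stmt-BirchSwinnertonDyer-23055 `PrintX10b.BeyondCarrierDepthX10b`, print leaf G87 = Howard Thm. 1.6.1 ↦ (plan g15 r8) the «Flach leaf»
C45.1′). Sequel of `CasselsTateSkewPairingDecompositionModelProofs` (the symplectic model pairing) and of the tree's α-PLUG
`EngineDecompositionsOfSkewPairingFactProofs` / `CasselsTateSkewPairingEngineDecompositionsProofs` (x9-p1 LEAD g9: C45.1′ ⇒
`HasLevelDecompositionsAt`).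

SOURCE. B. Howard, *The Heegner point Kolyvagin system*, Compositio Math. **140** (2004) = arXiv:1202.6340: Prop. 1.4.1 and the proof
of Thm. 1.4.2 (p0008 L83–L142; displays (i) «Proposition 1.4.1 therefore gives a nondegenerate pairing of `R/𝔪`-vector spaces
`( , )_{s,1} : V_s × W_s → R[𝔪]`» and (ii) «`(a, π^{s-1}b)_{s,1} = -(b, π^{s-1}a)_{s,1}`»), and §1.6 ¶1 (p0011 L33–44: «for `n ∈ 𝓝^{(k)}` we have a
decomposition `H¹_{𝓕(n)}(K, T^{(k)}) ≅ R^{(k),ε} ⊕ M^{(k)}(n) ⊕ M^{(k)}(n)`»).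

WHAT IS PROVED.
* **`DVRSetting.skewPairings_display_of_hasLevelDecompositionsAt`** — on a `DVRSetting` with H.0–H.5, from `S.HasLevelDecompositionsAt hy`
  (every `𝓗(n) = H¹_{𝓕(n)}(K, T^{(k)})`, `n ∈ 𝓝^{(k)}`, is `R`-equivariantly `≃ (R/𝔪^{e_k})^ε × (M × M)`, `M` finite): for every
  `t + 1 < e_k` the FIVE clauses of the typed leaf, VERBATIM — a bi-additive `R`-equivariant `P : 𝓗(n)[π^{t+1}] × 𝓗(n)[π] → R/𝔪` with
  LEFT kernel `π·𝓗(n)[π^{t+2}]`, RIGHT kernel `π^{t+1}·𝓗(n)[π^{t+2}]`, and `P(a, π^t b) = -P(b, π^t a)`.  Proof: `π^{e_k}` kills `𝓗(n)`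
  hence `M`; Macdonald II (1.3) (`Literature.Algebra.Module.exists_linearEquiv_pi_quotient_uniformizer_pow_of_isTorsion`:
  `M ≃ₗ Π_j R/(π^{n_j})`, `1 ≤ n_j ≤ e_k`); then the symplectic model pairing (`DecompositionModel.exists_skewPairing_of_linearEquiv`).
* **`prop141_casselsTate_skewPairing_atLevel_of_forall_hasLevelDecompositionsAt`** and
  **`prop141_casselsTate_skewPairing_atLevel_iff_forall_hasLevelDecompositionsAt`** — the ∃-typed leaf C45.1′ holds IFF every
  `DVRSetting` with H.0–H.5 has `HasLevelDecompositionsAt` (form (α) of the cell's pre-mint readings REF-160 / REF-162): `→` is the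
  tree's α-PLUG `hasLevelDecompositionsAt_of_prop141` (alternation via `2 ∈ R^×`, even dimension, structure theorem), `←` is new.

READING (numbers, for the desk): the typed C45.1′ thus carries exactly the content of Howard's §1.6 ¶1 display (Thm. 1.4.2 + Lemma 1.5.1 +
Rem. 1.3.1 as applied), no more: any kernel derivation of the levelwise decomposition — by Flach's pairing in whatever `(s,t)` / two-module /
value-module form, or otherwise — discharges the leaf BY NAME through `prop141_casselsTate_skewPairing_atLevel_of_forall_hasLevelDecompositionsAt`.

HONEST FRAMING: neither side of the equivalence is proved here; Flach's pairing is not constructed; Prop. 1.4.1, Thm. 1.4.2 and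
`thm161_dvrKolyvaginBound` are NOT proved; no summit statement is proved; the Birch–Swinnerton-Dyer conjecture is not proved by any of this.
-/

set_option autoImplicit false


namespace Literature.NumberTheory.GaloisCohomology.Howard2004

open Function NumberField IsDedekindDomain Field Module Submodule
open scoped NumberField ContRepresentation Pointwise
open Literature.NumberTheory.GaloisRepresentations
open Literature.NumberTheory.GaloisRepresentations.DiscreteGaloisModule

namespace DVRSetting

variable {p : ℕ} [Fact p.Prime] {K : Type} [Field K] [NumberField K]
  {R : Type} [CommRing R] [IsDomain R] [IsDiscreteValuationRing R] [Algebra ℤ_[p] R]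
  {N : ℕ → Type} [∀ k, AddCommGroup (N k)] [∀ k, TopologicalSpace (N k)]
  [∀ k, DiscreteTopology (N k)] [∀ k, Module R (N k)]
  {Rk : ℕ → Type} [∀ k, CommRing (Rk k)] [∀ k, IsLocalRing (Rk k)] [∀ k, TopologicalSpace (Rk k)]
  [∀ k, DiscreteTopology (Rk k)] [∀ k, Algebra ℤ_[p] (Rk k)] [∀ k, Algebra R (Rk k)]
  [∀ k, Module (Rk k) (N k)] [∀ k, IsScalarTower R (Rk k) (N k)]
  {Nbar : Type} [AddCommGroup Nbar] [TopologicalSpace Nbar] [DiscreteTopology Nbar]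
  [∀ k, Module (Rk k) Nbar]
  {Nq : ℕ → Finset (HeightOneSpectrum (𝓞 K)) → Type} [∀ k n, AddCommGroup (Nq k n)]
  [∀ k n, TopologicalSpace (Nq k n)] [∀ k n, DiscreteTopology (Nq k n)]
  [∀ k n, Module (Rk k) (Nq k n)] [∀ k n, Module R (Nq k n)]
  [∀ k n, IsScalarTower R (Rk k) (Nq k n)]

/-- **HOWARD'S DISPLAYS (i)(ii) OF THE PROOF OF THM. 1.4.2 FROM ITS CONCLUSION (converse of α-PLUG).** On a
`DVRSetting` with H.0–H.5, if every `𝓗(n) = H¹_{𝓕(n)}(K, T^{(k)})`, `n ∈ 𝓝^{(k)}`, decomposes `R`-equivariantly as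
`(R/𝔪^{e_k})^ε × (M × M)` (`S.HasLevelDecompositionsAt hy`, the shape of Thm. 1.4.2 / §1.6 ¶1), then for every
`t + 1 < e_k` there IS a bi-additive `R`-equivariant pairing `P : 𝓗(n)[π^{t+1}] × 𝓗(n)[π] → R/𝔪` with LEFT kernel
exactly `π·𝓗(n)[π^{t+2}]`, RIGHT kernel exactly `π^{t+1}·𝓗(n)[π^{t+2}]` and `P(a, π^t b) = -P(b, π^t a)` — the five
clauses of the typed print leaf `prop141_casselsTate_skewPairing_atLevel`, VERBATIM. Proof: Macdonald II (1.3)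
(`M ≅ Π_j R/(π^{n_j})`) and the symplectic model pairing `DecompositionModel.exists_skewPairing_of_linearEquiv`.
[cite: Howard2004HeegnerKolyvagin, Thm. 1.4.2 (proof, displays (i)(ii)) and §1.6 ¶1 (arXiv:1202.6340 p0008 L108–L142, p0011 L33–44)] -/
theorem skewPairings_display_of_hasLevelDecompositionsAt (S : DVRSetting p K R N Rk Nbar Nq) (hy : S.SatisfiesH)
    (hdec : S.HasLevelDecompositionsAt hy) (k : ℕ) (n : Finset (HeightOneSpectrum (𝓞 K)))
    (hn : ↑n ⊆ S.levelPrimes k) (t : ℕ) (ht : t + 1 < S.e k) :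
    ∃ P : ↥((((S.t k).atLevel S.jbar n).cond).selmerGroup ⊓
        (galoisCohomology.scalarMapH1 (S.T.ρ k) (S.T.hlin k) (S.π ^ (t + 1))).ker) →+
      ↥((((S.t k).atLevel S.jbar n).cond).selmerGroup ⊓
        (galoisCohomology.scalarMapH1 (S.T.ρ k) (S.T.hlin k) S.π).ker) →+ (R ⧸ IsLocalRing.maximalIdeal R),
      (∀ (r : R) (x x' : ↥((((S.t k).atLevel S.jbar n).cond).selmerGroup ⊓
          (galoisCohomology.scalarMapH1 (S.T.ρ k) (S.T.hlin k) (S.π ^ (t + 1))).ker))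
          (w : ↥((((S.t k).atLevel S.jbar n).cond).selmerGroup ⊓
            (galoisCohomology.scalarMapH1 (S.T.ρ k) (S.T.hlin k) S.π).ker)),
        (x' : galoisCohomology (S.T.ρ k) 1) =
          galoisCohomology.scalarMapH1 (S.T.ρ k) (S.T.hlin k) r (x : galoisCohomology (S.T.ρ k) 1) →
        P x' w = r • P x w) ∧
      (∀ (r : R) (x : ↥((((S.t k).atLevel S.jbar n).cond).selmerGroup ⊓
          (galoisCohomology.scalarMapH1 (S.T.ρ k) (S.T.hlin k) (S.π ^ (t + 1))).ker))
          (w w' : ↥((((S.t k).atLevel S.jbar n).cond).selmerGroup ⊓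
            (galoisCohomology.scalarMapH1 (S.T.ρ k) (S.T.hlin k) S.π).ker)),
        (w' : galoisCohomology (S.T.ρ k) 1) =
          galoisCohomology.scalarMapH1 (S.T.ρ k) (S.T.hlin k) r (w : galoisCohomology (S.T.ρ k) 1) →
        P x w' = r • P x w) ∧
      (∀ x : ↥((((S.t k).atLevel S.jbar n).cond).selmerGroup ⊓
          (galoisCohomology.scalarMapH1 (S.T.ρ k) (S.T.hlin k) (S.π ^ (t + 1))).ker),
        (∀ w, P x w = 0) ↔
          ∃ z ∈ (((S.t k).atLevel S.jbar n).cond).selmerGroup,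
            galoisCohomology.scalarMapH1 (S.T.ρ k) (S.T.hlin k) (S.π ^ (t + 2)) z = 0 ∧
            (x : galoisCohomology (S.T.ρ k) 1) = galoisCohomology.scalarMapH1 (S.T.ρ k) (S.T.hlin k) S.π z) ∧
      (∀ w : ↥((((S.t k).atLevel S.jbar n).cond).selmerGroup ⊓
          (galoisCohomology.scalarMapH1 (S.T.ρ k) (S.T.hlin k) S.π).ker),
        (∀ x, P x w = 0) ↔
          ∃ z ∈ (((S.t k).atLevel S.jbar n).cond).selmerGroup,
            galoisCohomology.scalarMapH1 (S.T.ρ k) (S.T.hlin k) (S.π ^ (t + 2)) z = 0 ∧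
            (w : galoisCohomology (S.T.ρ k) 1) =
              galoisCohomology.scalarMapH1 (S.T.ρ k) (S.T.hlin k) (S.π ^ (t + 1)) z) ∧
      (∀ (a b : ↥((((S.t k).atLevel S.jbar n).cond).selmerGroup ⊓
          (galoisCohomology.scalarMapH1 (S.T.ρ k) (S.T.hlin k) (S.π ^ (t + 1))).ker))
          (a' b' : ↥((((S.t k).atLevel S.jbar n).cond).selmerGroup ⊓
            (galoisCohomology.scalarMapH1 (S.T.ρ k) (S.T.hlin k) S.π).ker)),
        (a' : galoisCohomology (S.T.ρ k) 1) =
          galoisCohomology.scalarMapH1 (S.T.ρ k) (S.T.hlin k) (S.π ^ t) (a : galoisCohomology (S.T.ρ k) 1) →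
        (b' : galoisCohomology (S.T.ρ k) 1) =
          galoisCohomology.scalarMapH1 (S.T.ρ k) (S.T.hlin k) (S.π ^ t) (b : galoisCohomology (S.T.ρ k) 1) →
        P a b' = - P b a') := by
  classical
  letI modH : Module R (galoisCohomology (S.T.ρ k) 1) := galoisCohomology.moduleH1 (S.T.ρ k) (S.T.hlin k)
  have hsmul : ∀ (r : R) (x : galoisCohomology (S.T.ρ k) 1),
      r • x = galoisCohomology.scalarMapH1 (S.T.ρ k) (S.T.hlin k) r x := fun _ _ ↦ rfl
  have hπ : Irreducible S.π := (IsDiscreteValuationRing.irreducible_iff_uniformizer S.π).mpr hy.unif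
  have hL : ∀ (r : R) {x : galoisCohomology (S.T.ρ k) 1}, x ∈ (((S.t k).atLevel S.jbar n).cond).selmerGroup →
      galoisCohomology.scalarMapH1 (S.T.ρ k) (S.T.hlin k) r x ∈ (((S.t k).atLevel S.jbar n).cond).selmerGroup :=
    fun r _ hx ↦ S.scalarMapH1_mem_selmerGroup_atLevel hy k n r hx
  let L' : Submodule R (galoisCohomology (S.T.ρ k) 1) :=
    galoisCohomology.submoduleOfStable (S.T.hlin k) (((S.t k).atLevel S.jbar n).cond).selmerGroup hL
  -- the decomposition `θ : 𝓗(n) ≃ (R/𝔪^{e_k})^ε × (M × M)` of the hypothesis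
  obtain ⟨ε, -, M, _, _, _, θ, hθ⟩ := hdec k n hn
  -- `θ` as an `R`-linear equivalence on `L'`
  let Θ : ↥L' ≃ₗ[R] ((Fin ε → R ⧸ IsLocalRing.maximalIdeal R ^ S.e k) × (M × M)) :=
    { toFun := fun x ↦ θ ⟨x.1, x.2⟩
      invFun := fun y ↦ ⟨(θ.symm y).1, (θ.symm y).2⟩
      map_add' := fun x y ↦ by
        rw [← map_add]
        rfl
      map_smul' := fun r x ↦ by
        rw [RingHom.id_apply, ← hθ r x.1 x.2]
        rfl
      left_inv := fun x ↦ Subtype.ext (by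
        show ((θ.symm (θ ⟨x.1, x.2⟩) : _) : galoisCohomology (S.T.ρ k) 1) = x.1
        rw [AddEquiv.symm_apply_apply])
      right_inv := fun y ↦ by
        show θ ⟨(θ.symm y).1, (θ.symm y).2⟩ = y
        exact AddEquiv.apply_symm_apply θ y }
  -- `M` is killed by `π^{e_k}`, hence torsion of type `Π_j R/(π^{n_j})`, `1 ≤ n_j ≤ e_k`
  have hkill : ∀ y : galoisCohomology (S.T.ρ k) 1,
      galoisCohomology.scalarMapH1 (S.T.ρ k) (S.T.hlin k) (S.π ^ S.e k) y = 0 := fun y ↦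
    galoisCohomology.smul_eq_zero_of_forall (S.T.ρ k) (S.T.hlin k) _
      (fun mm ↦ hy.killed k _ (Ideal.pow_mem_pow (S.π_mem_maximalIdeal hy) _) mm) y
  have hMkill : ∀ mm : M, S.π ^ S.e k • mm = 0 := by
    intro mm
    obtain ⟨y, hy'⟩ := θ.surjective (0, (mm, 0))
    have h1 := hθ (S.π ^ S.e k) y.1 y.2
    have h2 : (⟨galoisCohomology.scalarMapH1 (S.T.ρ k) (S.T.hlin k) (S.π ^ S.e k) y.1,
        S.scalarMapH1_mem_selmerGroup_atLevel hy k n (S.π ^ S.e k) y.2⟩ :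
          ↥(((S.t k).atLevel S.jbar n).cond).selmerGroup) = 0 := Subtype.ext (hkill y.1)
    rw [h2, map_zero, show (⟨y.1, y.2⟩ : ↥(((S.t k).atLevel S.jbar n).cond).selmerGroup) = y from rfl,
      hy'] at h1
    have h3 := congr_arg (fun q ↦ q.2.1) h1
    simpa only [Prod.snd_zero, Prod.fst_zero, Prod.smul_snd, Prod.smul_fst] using h3.symm
  have hMtors : Module.IsTorsion R M := fun mm ↦
    ⟨⟨S.π ^ S.e k, mem_nonZeroDivisors_of_ne_zero (pow_ne_zero _ hπ.ne_zero)⟩, hMkill mm⟩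
  obtain ⟨m, nj, hnjpos, -, ⟨g⟩⟩ :=
    Literature.Algebra.Module.exists_linearEquiv_pi_quotient_uniformizer_pow_of_isTorsion hπ M hMtors
  have hnj : ∀ j, 1 ≤ nj j ∧ nj j ≤ S.e k := by
    intro j
    refine ⟨hnjpos j, (pow_dvd_pow_iff hπ.ne_zero hπ.not_isUnit).1 ?_⟩
    have h1 := hMkill (g.symm (Pi.single j (Ideal.Quotient.mk (Ideal.span {S.π ^ nj j}) 1)))
    rw [← map_smul, LinearEquiv.map_eq_zero_iff, ← Pi.single_smul] at h1
    have h2 := congr_fun h1 j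
    rw [Pi.single_eq_same, Pi.zero_apply, Algebra.smul_def, Ideal.Quotient.algebraMap_eq, ← map_mul, mul_one,
      Ideal.Quotient.eq_zero_iff_mem, Ideal.mem_span_singleton] at h2
    exact h2
  -- the model isomorphism `Φ : L' ≃ (R/π^{e_k})^ε × (Π_j R/π^{n_j})²`
  let Φ : ↥L' ≃ₗ[R] ((Fin ε → R ⧸ Ideal.span {S.π ^ S.e k}) ×
      ((Π j, R ⧸ Ideal.span {S.π ^ nj j}) × (Π j, R ⧸ Ideal.span {S.π ^ nj j}))) :=
    Θ.trans (LinearEquiv.prodCongr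
      (LinearEquiv.piCongrRight fun _ ↦
        Submodule.quotEquivOfEq _ _ (by rw [hy.unif, Ideal.span_singleton_pow]))
      (LinearEquiv.prodCongr g g))
  -- the two domains, cut out by membership
  have hA : ∀ x, x ∈ (((S.t k).atLevel S.jbar n).cond).selmerGroup ⊓
      (galoisCohomology.scalarMapH1 (S.T.ρ k) (S.T.hlin k) (S.π ^ (t + 1))).ker ↔
      x ∈ L' ∧ S.π ^ (t + 1) • x = 0 := fun x ↦ by
    rw [AddSubgroup.mem_inf, AddMonoidHom.mem_ker]
    rfl
  have hB : ∀ w, w ∈ (((S.t k).atLevel S.jbar n).cond).selmerGroup ⊓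
      (galoisCohomology.scalarMapH1 (S.T.ρ k) (S.T.hlin k) S.π).ker ↔
      w ∈ L' ∧ S.π • w = 0 := fun w ↦ by
    rw [AddSubgroup.mem_inf, AddMonoidHom.mem_ker]
    rfl
  obtain ⟨P, h₁, h₂, h₃, h₄, h₅⟩ := DecompositionModel.exists_skewPairing_of_linearEquiv hπ ε m (S.e k) nj hnj
    t ht L' Φ _ _ hA hB
  exact ⟨P, h₁, h₂, h₃, h₄, h₅⟩

end DVRSetting

/-- **C45.1′ FROM THM. 1.4.2-AS-APPLIED (form (α)), ALL SETTINGS AT ONCE**: if on every `DVRSetting` with H.0–H.5 every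
`H¹_{𝓕(n)}(K, T^{(k)})`, `n ∈ 𝓝^{(k)}`, decomposes as `(R/𝔪^{e_k})^ε × (M × M)` (`HasLevelDecompositionsAt`), then the typed
print leaf `prop141_casselsTate_skewPairing_atLevel` (Howard Prop. 1.4.1 / Flach 1990 with the displays (i)(ii) of the proof
of Thm. 1.4.2) holds — the converse of `hasLevelDecompositionsAt_of_prop141` (α-PLUG).
[cite: Howard2004HeegnerKolyvagin, Thm. 1.4.2 (proof, displays (i)(ii)) and §1.6 ¶1 (arXiv:1202.6340 p0008 L83–L142, p0011 L33–44)] -/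
theorem prop141_casselsTate_skewPairing_atLevel_of_forall_hasLevelDecompositionsAt
    (h : ∀ (p : ℕ) [Fact p.Prime] (K : Type) [Field K] [NumberField K]
      (R : Type) [CommRing R] [IsDomain R] [IsDiscreteValuationRing R] [Algebra ℤ_[p] R]
      (N : ℕ → Type) [∀ k, AddCommGroup (N k)] [∀ k, TopologicalSpace (N k)]
      [∀ k, DiscreteTopology (N k)] [∀ k, Module R (N k)]
      (Rk : ℕ → Type) [∀ k, CommRing (Rk k)] [∀ k, IsLocalRing (Rk k)] [∀ k, TopologicalSpace (Rk k)]
      [∀ k, DiscreteTopology (Rk k)] [∀ k, Algebra ℤ_[p] (Rk k)] [∀ k, Algebra R (Rk k)]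
      [∀ k, Module (Rk k) (N k)] [∀ k, IsScalarTower R (Rk k) (N k)]
      (Nbar : Type) [AddCommGroup Nbar] [TopologicalSpace Nbar] [DiscreteTopology Nbar]
      [∀ k, Module (Rk k) Nbar]
      (Nq : ℕ → Finset (HeightOneSpectrum (𝓞 K)) → Type) [∀ k n, AddCommGroup (Nq k n)]
      [∀ k n, TopologicalSpace (Nq k n)] [∀ k n, DiscreteTopology (Nq k n)]
      [∀ k n, Module (Rk k) (Nq k n)] [∀ k n, Module R (Nq k n)]
      [∀ k n, IsScalarTower R (Rk k) (Nq k n)]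
      (S : DVRSetting p K R N Rk Nbar Nq) (hy : S.SatisfiesH), S.HasLevelDecompositionsAt hy) :
    prop141_casselsTate_skewPairing_atLevel := by
  intro p _ K _ _ R _ _ _ _ N _ _ _ _ Rk _ _ _ _ _ _ _ _ Nbar _ _ _ _ Nq _ _ _ _ _ _ S hy k n hn t ht
  exact S.skewPairings_display_of_hasLevelDecompositionsAt hy (h p K R N Rk Nbar Nq S hy) k n hn t ht

/-- **THE TYPED LEAF C45.1′ IS KERNEL-EQUIVALENT TO THM. 1.4.2-AS-APPLIED (form (α)).** The ∃-typed print fact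
`prop141_casselsTate_skewPairing_atLevel` (Howard's displays (i)(ii): a nondegenerate `R/𝔪`-valued pairing
`( , )_{s,1} : V_s × W_s → R[𝔪]` with the skew identity, on every `𝓗(n) = H¹_{𝓕(n)}(K, T^{(k)})`, `n ∈ 𝓝^{(k)}`) holds
IF AND ONLY IF every such `𝓗(n)` decomposes `R`-equivariantly as `(R/𝔪^{e_k})^ε ⊕ M ⊕ M` (`HasLevelDecompositionsAt`,
Howard §1.6 ¶1: «for `n ∈ 𝓝^{(k)}` we have a decomposition `H¹_{𝓕(n)}(K, T^{(k)}) ≅ R^{(k),ε} ⊕ M^{(k)}(n) ⊕ M^{(k)}(n)`»):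
`→` is the tree's α-PLUG (`hasLevelDecompositionsAt_of_prop141`: alternation, even dimension, structure theorem), `←` is
the symplectic model pairing of this file. Neither side is proved here; BSD is not proved by this.
[cite: Howard2004HeegnerKolyvagin, Prop. 1.4.1, Thm. 1.4.2 (with proof) and §1.6 ¶1 (arXiv:1202.6340 p0008 L83–L142, p0011 L33–44)] -/
theorem prop141_casselsTate_skewPairing_atLevel_iff_forall_hasLevelDecompositionsAt :
    prop141_casselsTate_skewPairing_atLevel ↔
    ∀ (p : ℕ) [Fact p.Prime] (K : Type) [Field K] [NumberField K]
      (R : Type) [CommRing R] [IsDomain R] [IsDiscreteValuationRing R] [Algebra ℤ_[p] R]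
      (N : ℕ → Type) [∀ k, AddCommGroup (N k)] [∀ k, TopologicalSpace (N k)]
      [∀ k, DiscreteTopology (N k)] [∀ k, Module R (N k)]
      (Rk : ℕ → Type) [∀ k, CommRing (Rk k)] [∀ k, IsLocalRing (Rk k)] [∀ k, TopologicalSpace (Rk k)]
      [∀ k, DiscreteTopology (Rk k)] [∀ k, Algebra ℤ_[p] (Rk k)] [∀ k, Algebra R (Rk k)]
      [∀ k, Module (Rk k) (N k)] [∀ k, IsScalarTower R (Rk k) (N k)]
      (Nbar : Type) [AddCommGroup Nbar] [TopologicalSpace Nbar] [DiscreteTopology Nbar]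
      [∀ k, Module (Rk k) Nbar]
      (Nq : ℕ → Finset (HeightOneSpectrum (𝓞 K)) → Type) [∀ k n, AddCommGroup (Nq k n)]
      [∀ k n, TopologicalSpace (Nq k n)] [∀ k n, DiscreteTopology (Nq k n)]
      [∀ k n, Module (Rk k) (Nq k n)] [∀ k n, Module R (Nq k n)]
      [∀ k n, IsScalarTower R (Rk k) (Nq k n)]
      (S : DVRSetting p K R N Rk Nbar Nq) (hy : S.SatisfiesH), S.HasLevelDecompositionsAt hy :=
  ⟨fun h141 _ _ _ _ _ _ _ _ _ _ _ _ _ _ _ _ _ _ _ _ _ _ _ _ _ _ _ _ _ _ _ _ _ _ _ _ S hy ↦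
    S.hasLevelDecompositionsAt_of_prop141 h141 hy,
   prop141_casselsTate_skewPairing_atLevel_of_forall_hasLevelDecompositionsAt⟩

end Literature.NumberTheory.GaloisCohomology.Howard2004
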